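import Mathlib
import Summits.ValiantsHypothesis.ValiantsHypothesis.Theses.ValuativeGCT
import Literature.Computability.Complexity.OccurrenceObstructionsBIP
import Summits.ValiantsHypothesis.ValiantsHypothesis.Theorems.ValuativeGCTValuativeBound
import Summits.ValiantsHypothesis.ValiantsHypothesis.Theorems.ValuativeGCTValuativeFlipIsotypicSliceBound
import Summits.ValiantsHypothesis.ValiantsHypothesis.Theorems.ValuativeGCTValuativeFlipFourRowBridgePer

/-!
# Per-side few-row Hilbert cap: `mult_{λ*} ℂ[Δ_m(X₀₀^{m-n} per_n)] ≤ C(k(n²+1) + mδ − 1, mδ)` on `≤ k`-row shapes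

Companion to the det census of the wall-breaker axis "det-orbit-closure multiplicity bounds for
detCensus" (crux `ValuativeGCT.ValuativeFlip`, stmt-ValiantsHypothesis-12624): the quantity the
det census has to stay BELOW.  A `B`-semi-invariant of weight `λ*` in the coordinate ring of the
orbit closure of the padded permanent, realised as a polynomial on `End W` (`hwToPoly`,
`W = ℂ^{m×m}`), is

* homogeneous of degree `mδ` (the weight pins the degree, `isHomogeneous_orbitCoordToPoly`),
* a function of the ROWS `j` of `A ∈ End W` carrying a nonzero part of `λ` only — at most
  `ℓ(λ) ≤ k` of them, the top `k` slots (torus part of the Borel clause: semi-invariants are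
  multihomogeneous in the row slots, `iso_isWeightedHomogeneous_of_semiInvariant`;
  `psc_mem_supported_rows`),
* a function of the COLUMNS `i` of `A` indexing a variable of `X₀₀^{m-n} per_n` only — at most
  `n² + 1` of them (`psc_genericOrbitMap_mem_supported_cols`, `vars_paddedPerFormLex_subset`).

So it is a form of degree `mδ` in at most `k(n²+1)` entries of `A`, whence (stars and bars,
`psc_finrank_hom_supported_le`)

  `P_m(λ) := orbitMultiplicity (paddedPerFormLex ℂ n m) m λ* ≤ C(k(n²+1) + mδ − 1, mδ)`   (`perSide_rowCap`)

for every `λ ⊢ mδ` with at most `k ≤ m²` parts — polynomial in `δ` of degree `k(n²+1) − 1`,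
uniformly in the shape.  Reading against the det census (`isotypicBinomialBound`,
`C(λ₂+m,m)·∏_{i≥3} C(λ_i+m²−1,m²−1) ~ δ^((k−2)(m²−1)+m)` for parts `~ δ`): a binomial certificate
`census(λ) < P_m(λ)` on a `k`-row shape with large parts needs `(k−2)(m²−1)+m < k(n²+1)`, i.e.
`m ≲ n·√(k/(k−2))` — the head of the window (`perSide_rowCap_noCertificate` records the logic).
Elementary over the tree's `hwToPoly` / `orbitCoordToPoly` API; no named facts, no definitions.
-/

set_option linter.dupNamespace false

namespace Summit.ValiantsHypothesis.ValiantsHypothesis.Theorems.ValuativeFlip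

open MvPolynomial
open scoped BigOperators Matrix
open Literature.NumberTheory.DiophantineGeometry
open Literature.Computability.AlgebraicComplexity
open Literature.Computability.Complexity

noncomputable section

variable {m : ℕ}

/-! ## Columns: the generic orbit map only uses the columns indexing variables of `f` -/

/-- Linear substitutions of a polynomial supported on `S` only read the columns `i ∈ S` of the
matrix. [folklore] -/
theorem psc_linSubst_eq_of_eqOn {S : Set (MatIdx m)} {f : MvPolynomial (MatIdx m) ℂ}
    (hf : f ∈ supported ℂ S) (A A' : Matrix (MatIdx m) (MatIdx m) ℂ)
    (hAA' : ∀ j i, i ∈ S → A j i = A' j i) :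
    linSubst (MatIdx m) ℂ A f = linSubst (MatIdx m) ℂ A' f := by
  rw [supported_eq_range_rename, AlgHom.mem_range] at hf
  obtain ⟨f₀, rfl⟩ := hf
  unfold linSubst
  rw [aeval_rename, aeval_rename]
  have hcomp : ((fun i : MatIdx m => ∑ j, A j i • (X j : MvPolynomial (MatIdx m) ℂ)) ∘ (Subtype.val : S → MatIdx m)) =
      (fun i : MatIdx m => ∑ j, A' j i • (X j : MvPolynomial (MatIdx m) ℂ)) ∘ (Subtype.val : S → MatIdx m) := by
    funext i
    simp only [Function.comp_apply]
    exact Finset.sum_congr rfl fun j _ => by rw [hAA' j i.1 i.2]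
  rw [hcomp]

/-- **Column support of the generic orbit map.**  If `f` is supported on the variables `S`, then
`Φ F = (A ↦ F(A · f))` is a polynomial in the entries `A_{j i}` with `i ∈ S` only (killing the
other columns of `A` does not change `A · f`). [folklore; Mulmuley–Sohoni 2001 §4] -/
theorem psc_genericOrbitMap_mem_supported_cols {S : Set (MatIdx m)} {f : MvPolynomial (MatIdx m) ℂ}
    (hf : f ∈ supported ℂ S) (F : MvPolynomial (DegIdx (MatIdx m) m) ℂ) :
    genericOrbitMap f m F ∈ supported ℂ {q : MatIdx m × MatIdx m | q.2 ∈ S} := by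
  classical
  set κ : MatIdx m × MatIdx m → MvPolynomial (MatIdx m × MatIdx m) ℂ :=
    fun q => if q.2 ∈ S then X q else 0 with hκ
  have hκrange : (MvPolynomial.aeval (R := ℂ) κ).range ≤
      supported ℂ {q : MatIdx m × MatIdx m | q.2 ∈ S} := by
    rw [aeval_range, Algebra.adjoin_le_iff]
    rintro _ ⟨q, rfl⟩
    by_cases hq : q.2 ∈ S
    · simp only [hκ, if_pos hq]
      exact (X_mem_supported (R := ℂ) (s := {q : MatIdx m × MatIdx m | q.2 ∈ S}) (i := q)).mpr hq
    · simp only [hκ, if_neg hq]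
      exact Subalgebra.zero_mem _
  have hfix : MvPolynomial.aeval κ (genericOrbitMap f m F) = genericOrbitMap f m F := by
    apply MvPolynomial.funext
    intro x
    rw [frb_eval_aeval]
    have hx' : (fun q : MatIdx m × MatIdx m => MvPolynomial.eval x (κ q)) =
        fun ij : MatIdx m × MatIdx m =>
          (Matrix.of fun j i : MatIdx m => if i ∈ S then x (j, i) else 0) ij.1 ij.2 := by
      funext q
      simp only [hκ, Matrix.of_apply]
      split_ifs <;> simp
    have hx : x = fun ij : MatIdx m × MatIdx m => (Matrix.of fun j i : MatIdx m => x (j, i)) ij.1 ij.2 := by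
      funext q
      simp
    rw [hx', eval_genericOrbitMap]
    conv_rhs => rw [hx, eval_genericOrbitMap]
    rw [psc_linSubst_eq_of_eqOn hf _ (Matrix.of fun j i : MatIdx m => x (j, i))]
    intro j i hi
    simp [hi]
  rw [← hfix]
  exact hκrange ⟨genericOrbitMap f m F, rfl⟩

/-! ## Rows: the torus part of the Borel clause -/

/-- The Borel clause as a polynomial identity for ANY form `f`: substituting `A ↦ g⁻¹ A` in the
polynomial attached to a weight-`χ` highest-weight class multiplies it by `weightChar χ g`
(`eval_orbitCoordToPoly_mul_left` upgraded by `GL`-density). [folklore] -/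
theorem psc_borel_clause_poly (f : MvPolynomial (MatIdx m) ℂ)
    {F : MvPolynomial (DegIdx (MatIdx m) m) ℂ} {χ : Weight (MatIdx m)}
    (hx : Ideal.Quotient.mk (orbitVanishingIdeal f m) F ∈ highestWeightSpace (orbitCoordRep f m) χ)
    {g : GL (MatIdx m) ℂ} (hg : IsUpperTriangular g) :
    aeval (R := ℂ) (fun p : MatIdx m × MatIdx m =>
        ∑ l : MatIdx m, ((g⁻¹ : GL (MatIdx m) ℂ) : Matrix (MatIdx m) (MatIdx m) ℂ) p.1 l • X (l, p.2))
        (orbitCoordToPoly f m (Ideal.Quotient.mk (orbitVanishingIdeal f m) F)) =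
      weightChar χ g • orbitCoordToPoly f m (Ideal.Quotient.mk (orbitVanishingIdeal f m) F) := by
  apply MvPolynomial.eq_of_eval_eq_on_gl
  intro g'
  have hfun : (fun i : MatIdx m × MatIdx m =>
      eval (fun ij : MatIdx m × MatIdx m => (g' : Matrix (MatIdx m) (MatIdx m) ℂ) ij.1 ij.2)
        (∑ l : MatIdx m, ((g⁻¹ : GL (MatIdx m) ℂ) : Matrix (MatIdx m) (MatIdx m) ℂ) i.1 l •
          X (l, i.2))) =
      fun ij => (((g⁻¹ : GL (MatIdx m) ℂ) : Matrix (MatIdx m) (MatIdx m) ℂ) *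
        (g' : Matrix (MatIdx m) (MatIdx m) ℂ)) ij.1 ij.2 := by
    funext ij
    simp [Matrix.mul_apply, smul_eval]
  have hsign := eval_orbitCoordToPoly_mul_left f m hx ((borelSubgroup _ _).inv_mem hg) g'
  rw [weightChar_inv χ hg, inv_inv] at hsign
  rw [smul_eval, ← hsign, frb_eval_aeval, hfun]

/-- **Row support.**  The polynomial attached to a weight-`χ` highest-weight class only involves the
rows `j` of `A` with `χ j ≠ 0`: it is weighted homogeneous of weight `-χ` for the row weights
(`iso_isWeightedHomogeneous_of_semiInvariant`), and a variable of row `j` in a monomial makes the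
row weight at `j` positive. [folklore] -/
theorem psc_mem_supported_rows (f : MvPolynomial (MatIdx m) ℂ)
    {F : MvPolynomial (DegIdx (MatIdx m) m) ℂ} {χ : Weight (MatIdx m)}
    (hx : Ideal.Quotient.mk (orbitVanishingIdeal f m) F ∈ highestWeightSpace (orbitCoordRep f m) χ) :
    orbitCoordToPoly f m (Ideal.Quotient.mk (orbitVanishingIdeal f m) F) ∈
      supported ℂ {q : MatIdx m × MatIdx m | χ q.1 < 0} := by
  classical
  set P := orbitCoordToPoly f m (Ideal.Quotient.mk (orbitVanishingIdeal f m) F) with hP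
  have hW : IsWeightedHomogeneous (fun p : MatIdx m × MatIdx m => (Pi.single p.1 (1 : ℤ) : MatIdx m → ℤ))
      P (-χ) :=
    iso_isWeightedHomogeneous_of_semiInvariant χ P fun g hg => psc_borel_clause_poly f hx hg
  rw [mem_supported]
  intro q hq
  rw [Finset.mem_coe, mem_vars_iff_mem_support] at hq
  obtain ⟨s, hs, hqs⟩ := hq
  have hws : Finsupp.weight (fun p : MatIdx m × MatIdx m => (Pi.single p.1 (1 : ℤ) : MatIdx m → ℤ)) s = -χ :=
    hW (mem_support_iff.mp hs)
  have hle := iso_le_weight_apply (fun p : MatIdx m × MatIdx m => p.1) s q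
  rw [hws, Pi.neg_apply] at hle
  have hpos : 0 < s q := Nat.pos_of_ne_zero (Finsupp.mem_support_iff.mp hqs)
  show χ q.1 < 0
  omega

/-! ## Counting forms in few variables -/

/-- **Stars and bars for supported forms.**  The degree-`D` forms in the variables of a finite set
`T` span a space of dimension at most `C(#T + D − 1, D)` (they are spanned by the monomials with
exponent vector supported in `T` of degree `D`, `Finset.card_finsuppAntidiag_nat_eq_choose`).
[folklore] -/
theorem psc_finrank_hom_supported_le {τ : Type*} [DecidableEq τ] (T : Finset τ) (D : ℕ) :
    Module.finrank ℂ ↥(homogeneousSubmodule τ ℂ D ⊓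
        Subalgebra.toSubmodule (supported ℂ (↑T : Set τ))) ≤ (T.card + D - 1).choose D := by
  classical
  set B : Finset (MvPolynomial τ ℂ) := (T.finsuppAntidiag D).image fun s => monomial s (1 : ℂ) with hB
  have hle : homogeneousSubmodule τ ℂ D ⊓ Subalgebra.toSubmodule (supported ℂ (↑T : Set τ)) ≤
      Submodule.span ℂ (↑B : Set (MvPolynomial τ ℂ)) := by
    intro p hp
    obtain ⟨hhom, hsupp⟩ := Submodule.mem_inf.mp hp
    rw [mem_homogeneousSubmodule] at hhom
    have hsupp' : (↑p.vars : Set τ) ⊆ ↑T := mem_supported.mp hsupp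
    rw [p.as_sum]
    refine Submodule.sum_mem _ fun s hs => ?_
    have hsT : s ∈ T.finsuppAntidiag D := by
      rw [Finset.mem_finsuppAntidiag]
      have hsub : s.support ⊆ T := fun i hi =>
        Finset.mem_coe.mp (hsupp' (Finset.mem_coe.mpr ((mem_vars_iff_mem_support i).mpr ⟨s, hs, hi⟩)))
      refine ⟨?_, hsub⟩
      have hdeg := hhom (mem_support_iff.mp hs)
      rw [Finsupp.weight_apply, Finsupp.sum] at hdeg
      simp only [Pi.one_apply, smul_eq_mul, mul_one] at hdeg
      rw [← hdeg]
      exact (Finset.sum_subset hsub fun i _ hi => Finsupp.notMem_support_iff.mp hi).symm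
    have : monomial s (coeff s p) = coeff s p • monomial s (1 : ℂ) := by
      rw [smul_monomial, smul_eq_mul, mul_one]
    rw [this]
    exact Submodule.smul_mem _ _ (Submodule.subset_span (Finset.mem_coe.mpr
      (Finset.mem_image.mpr ⟨s, hsT, rfl⟩)))
  calc Module.finrank ℂ ↥(homogeneousSubmodule τ ℂ D ⊓ Subalgebra.toSubmodule (supported ℂ (↑T : Set τ)))
      ≤ Module.finrank ℂ (Submodule.span ℂ (↑B : Set (MvPolynomial τ ℂ))) := Submodule.finrank_mono hle
    _ ≤ B.card := finrank_span_finset_le_card B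
    _ ≤ (T.finsuppAntidiag D).card := Finset.card_image_le
    _ = (T.card + D - 1).choose D := Finset.card_finsuppAntidiag_nat_eq_choose D

/-! ## The cap -/

/-- The top `k` row slots (`m² ≤ idx j + k`) are at most `k` in number. [folklore] -/
theorem psc_card_topSlots_le (m k : ℕ) :
    (Finset.univ.filter fun j : MatIdx m => m * m ≤ (((matIdxEquiv m).symm j : Fin (m * m)) : ℕ) + k).card ≤ k := by
  classical
  have h := Finset.card_le_card_of_injOn (s := Finset.univ.filter fun j : MatIdx m =>
      m * m ≤ (((matIdxEquiv m).symm j : Fin (m * m)) : ℕ) + k) (t := Finset.range k)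
    (fun j => m * m - 1 - (((matIdxEquiv m).symm j : Fin (m * m)) : ℕ)) ?_ ?_
  · simpa only [Finset.card_range] using h
  · intro j hj
    have hj' := (Finset.mem_filter.mp (Finset.mem_coe.mp hj)).2
    have hlt := ((matIdxEquiv m).symm j).2
    refine Finset.mem_coe.mpr (Finset.mem_range.mpr ?_)
    dsimp only
    omega
  · intro j hj j' hj' hjj'
    have h1 := ((matIdxEquiv m).symm j).2
    have h2 := ((matIdxEquiv m).symm j').2
    have hval : (((matIdxEquiv m).symm j : Fin (m * m)) : ℕ) = ((matIdxEquiv m).symm j' : Fin (m * m)) := by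
      simp only at hjj'
      omega
    exact (matIdxEquiv m).symm.injective (Fin.ext hval)

/-- **Per-side few-row Hilbert cap.**  For `n ≤ m`, every degree `δ`, and every shape `λ ⊢ mδ` with
at most `k ≤ m²` parts, the multiplicity of `λ*` in the coordinate ring of the orbit closure of the
padded permanent satisfies
`P_m(λ) = mult_{λ*} ℂ[Δ_m(X₀₀^{m-n} per_n)] ≤ C(k(n²+1) + mδ − 1, mδ)`:
a weight-`λ*` semi-invariant, as a polynomial on `End W`, is a form of degree `mδ` in the
`≤ k(n²+1)` entries `A_{j i}` with `j` one of the top `k` row slots and `i` one of the `≤ n²+1`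
variables of `X₀₀^{m-n} per_n`.  Polynomial in `δ` of degree `k(n²+1) − 1` uniformly in the shape:
the per side has nothing beyond `k(n²+1)` dimensions on `k` rows. [folklore; Mulmuley–Sohoni 2001
§4–§5, Kadish–Landsberg 2014 §1 (few-row restriction)] -/
theorem perSide_rowCap : ∀ (n m : ℕ) [NeZero m], n ≤ m → ∀ (δ k : ℕ) (lam : Nat.Partition (m * δ)), lam.parts.card ≤ k → k ≤ m * m → orbitMultiplicity ℂ (paddedPerFormLex ℂ n m) m ((Weight.dualOfPartition (m * m) lam).toMatIdx : Weight (MatIdx m)) ≤ (k * (n ^ 2 + 1) + m * δ - 1).choose (m * δ) := by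
  intro n m _ hnm δ k lam hk hkm
  classical
  set f := paddedPerFormLex ℂ n m with hf
  set χ : Weight (MatIdx m) := (Weight.dualOfPartition (m * m) lam).toMatIdx with hχ
  set KeptF : Finset (MatIdx m) := Finset.univ.filter fun j : MatIdx m =>
    m * m ≤ (((matIdxEquiv m).symm j : Fin (m * m)) : ℕ) + k with hKeptF
  set RelF : Finset (MatIdx m) := insert (toLex ((0 : Fin m), (0 : Fin m)) : MatIdx m)
    (Finset.univ.image fun ij : BlockIdx n m × BlockIdx n m =>
      (toLex ((ij.1 : Fin m), (ij.2 : Fin m)) : MatIdx m)) with hRelF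
  set T : Finset (MatIdx m × MatIdx m) := KeptF ×ˢ RelF with hT
  set V : Submodule ℂ (MvPolynomial (MatIdx m × MatIdx m) ℂ) :=
    homogeneousSubmodule (MatIdx m × MatIdx m) ℂ (m * δ) ⊓
      Subalgebra.toSubmodule (supported ℂ (↑T : Set (MatIdx m × MatIdx m))) with hV
  -- the semi-invariants land in `V`
  have hrange : LinearMap.range (hwToPoly f m χ) ≤ V := by
    rintro _ ⟨x, rfl⟩
    rw [hwToPoly_apply]
    obtain ⟨F, hFx⟩ := Ideal.Quotient.mk_surjective (x : OrbitCoordRing f m)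
    have hx : Ideal.Quotient.mk (orbitVanishingIdeal f m) F ∈ highestWeightSpace (orbitCoordRep f m) χ := by
      rw [hFx]; exact x.2
    rw [← hFx]
    refine Submodule.mem_inf.mpr ⟨?_, ?_⟩
    · exact (mem_homogeneousSubmodule _ _).mpr
        (isHomogeneous_orbitCoordToPoly f m hx (size_toMatIdx_dualOfPartition m lam (hk.trans hkm)))
    · -- rows and columns
      have hrows := psc_mem_supported_rows f hx
      have hcols : orbitCoordToPoly f m (Ideal.Quotient.mk (orbitVanishingIdeal f m) F) ∈
          supported ℂ {q : MatIdx m × MatIdx m | q.2 ∈ (↑RelF : Set (MatIdx m))} := by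
        rw [orbitCoordToPoly_mk]
        exact psc_genericOrbitMap_mem_supported_cols
          (mem_supported.mpr (vars_paddedPerFormLex_subset (k := ℂ) n m)) F
      rw [Subalgebra.mem_toSubmodule, mem_supported]
      rw [mem_supported] at hrows hcols
      intro q hq
      have h1 : χ q.1 < 0 := hrows hq
      have h2 : q.2 ∈ RelF := hcols hq
      rw [Finset.mem_coe, hT, Finset.mem_product]
      refine ⟨?_, h2⟩
      rw [hKeptF, Finset.mem_filter]
      refine ⟨Finset.mem_univ _, ?_⟩
      -- `χ q.1 < 0` forces `q.1` into the top `k` slots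
      have hval := neg_toMatIdx_dualOfPartition_toNat m lam ((matIdxEquiv m).symm q.1)
      rw [OrderIso.apply_symm_apply] at hval
      by_contra hlt
      have hidx : lam.parts.card ≤ m * m - 1 - (((matIdxEquiv m).symm q.1 : Fin (m * m)) : ℕ) := by
        have := ((matIdxEquiv m).symm q.1).2
        omega
      have hzero : lam.sortedParts.getD (m * m - 1 - (((matIdxEquiv m).symm q.1 : Fin (m * m)) : ℕ)) 0 = 0 :=
        List.getD_eq_default _ _ (by rw [Nat.Partition.length_sortedParts]; exact hidx)
      rw [hzero] at hval
      have hval' : (-(χ q.1)).toNat = 0 := hval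
      omega
  -- count
  haveI : Module.Finite ℂ ↥(homogeneousSubmodule (MatIdx m × MatIdx m) ℂ (m * δ)) :=
    Module.Finite.iff_fg.mpr (homogeneousSubmodule_fg _ _ _)
  haveI : Module.Finite ℂ ↥V := Submodule.finiteDimensional_of_le inf_le_left
  have hcardT : T.card ≤ k * (n ^ 2 + 1) := by
    rw [hT, Finset.card_product]
    exact Nat.mul_le_mul (psc_card_topSlots_le m k) (card_insert_image_blockIdx_le n m hnm)
  have hfin : orbitMultiplicity ℂ f m χ ≤ Module.finrank ℂ ↥V := by
    calc orbitMultiplicity ℂ f m χ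
        = Module.finrank ℂ (highestWeightSpace (orbitCoordRep f m) χ) := rfl
      _ = Module.finrank ℂ (LinearMap.range (hwToPoly f m χ)) :=
          (LinearMap.finrank_range_of_inj (hwToPoly_injective _ _ _)).symm
      _ ≤ Module.finrank ℂ ↥V := Submodule.finrank_mono hrange
  exact hfin.trans ((psc_finrank_hom_supported_le T (m * δ)).trans
    (Nat.choose_le_choose _ (Nat.sub_le_sub_right (Nat.add_le_add_right hcardT _) 1)))

/-- **No binomial certificate below the cap.**  If on a shape `λ ⊢ mδ` with at most `k ≤ m²` parts
the per-side cap `C(k(n²+1) + mδ − 1, mδ)` does not exceed the binomial det census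
`C(λ₂+m, m)·∏_{i≥3} C(λ_i+m²−1, m²−1)` (`isotypicBinomialBound`), then no per-side certificate
can beat that census on `λ` (`census < P_m(λ)` is impossible).  For `k` rows with parts `~ δ` the
cap is `~ δ^(k(n²+1)−1)` against the census `~ δ^((k−2)(m²−1)+m)`, so binomial certificates on
few-row shapes with large parts live only where `(k−2)(m²−1)+m < k(n²+1)`: the head `m ≲ n·√(k/(k−2))`.
[this crux; reading of the det census] -/
theorem perSide_rowCap_noCertificate (n m : ℕ) [NeZero m] (hnm : n ≤ m) (δ k : ℕ)
    (lam : Nat.Partition (m * δ)) (hk : lam.parts.card ≤ k) (hkm : k ≤ m * m)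
    (hcap : (k * (n ^ 2 + 1) + m * δ - 1).choose (m * δ) ≤
      (lam.sortedParts.getD 1 0 + m).choose m *
        ∏ i ∈ Finset.Ico 2 (m * m), (lam.sortedParts.getD i 0 + (m * m - 1)).choose (m * m - 1)) :
    ¬ ((lam.sortedParts.getD 1 0 + m).choose m *
        ∏ i ∈ Finset.Ico 2 (m * m), (lam.sortedParts.getD i 0 + (m * m - 1)).choose (m * m - 1) <
      orbitMultiplicity ℂ (paddedPerFormLex ℂ n m) m
        ((Weight.dualOfPartition (m * m) lam).toMatIdx : Weight (MatIdx m))) :=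
  fun h => absurd (lt_of_le_of_lt hcap h) (not_lt.mpr (perSide_rowCap n m hnm δ k lam hk hkm))

end

end Summit.ValiantsHypothesis.ValiantsHypothesis.Theorems.ValuativeFlip
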